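import Literature.Computability.AlgebraicComplexity.CoppersmithWinograd1982Improvable
import Literature.Computability.AlgebraicComplexity.SchonhageRectangular
import Literature.Computability.AlgebraicComplexity.AsymptoticRankBorderRank
import Literature.Computability.AlgebraicComplexity.RectangularExponentUnidimensionalAsymptotics
import Literature.Barriers.MatrixMultiplication.UniversalMethodBarrier
import Literature.Barriers.MatrixMultiplication.UniversalMethodBarrierAsymptoticRank
import Literature.Barriers.MatrixMultiplication.UniversalMethodBarrierThm29
import HarnessLib

/-!
# Route `FarEdgeDescent` — the Knuth–Coppersmith–Winograd plateau of the far-edge excess (kernel XXIII-a)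

decomp-mm ROOT cell (D-0178), lens 2 «structural dichotomy: special vs generic», gen 47.  THESES-FREE
(imports `Literature` only): the tensor and plateau layers of the proof of the route aside `SubLogRate`
(stmt-MatrixMultiplication-25371), which is closed BY NAME in `Theorems/FarEdgeDescentSubLogRate.lean`.

Write `e(x) = ω(1,x,1) − (x+1) ≥ 0` for the excess of the far-rectangular exponent over its information
floor (antitone in `x`: `omegaRect_one_mid_one_sub_antitone`).  Over an infinite field let `a ≥ 2`, `b ≥ 1`,
`ρ = R(⟨a,b,a⟩)` and `q = ρ + b − 2ab` (the Knuth BONUS: Coppersmith–Winograd 1982 in Knuth's form,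
`bR(⟨a,b,a⟩ ⊕ ⟨1,q,1⟩) ≤ ρ + b`, tree theorem `algBorderRank_matMulDirectSum_augment_le`).

* §2 `tensorRestrictsTo_kroneckerPow_twoBlocks_single` — the `n+1` words of `(⟨a,b,a⟩ ⊕ ⟨1,q,1⟩)^{⊗(n+1)}`
  with exactly one block `⟨a,b,a⟩` restrict it to `⟨n+1⟩ ⊗ ⟨a, b qⁿ, a⟩` (one type class; the landed
  restriction form `tensorRestrictsTo_kroneckerPow_matMulDirectSum_multiple` of Bläser's block extraction).
* §3 `knuth_packing_bound` — `(n+1)·a^{ω(1,x,1)} ≤ (ρ+b)^{n+1}` whenever `aˣ ≤ b qⁿ` (border rank ⟹ asymptotic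
  rank ⟹ powers ⟹ restriction ⟹ the rectangular asymptotic sum inequality with multiplicity
  `mul_rpow_omegaRect_mid_le_asymptoticRank`).
* §4 `excess_plateau` — with `b = a^β` and `Λ = q/a^{β+1} ≥ 2`:  `e(k) ≤ 3 / log a` for every real
  `k ≥ β + Λ·log(ρ + a^β)/log a` (take `n = ⌊Λ⌋` copies at the format `x = β + n log q/log a`, where `aˣ = a^β qⁿ`
  exactly; then `e(x)·log a ≤ (n+1)·log((ρ+a^β)/q) + log Λ − log(n+1) ≤ 2(n+1)/Λ ≤ 3`, and antitonicity).

This is the `u = 2/n` one-type-class step of Lotti–Romani (1983, Prop. 4.1) run on the Knuth–CW augmentation,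
whose bonus `Λ` is NOT tied to the format (Schönhage's `⟨n,1,n⟩ ⊕ ⟨1,(n−1)²,1⟩` has `Λ ≍ 1` per unit of `log`-format
and certifies only `e = O(1/log k)`); the growth `Λ_a ≥ a^{e(β)} − 2` is harvested in the sequel file.
NO definitions (gate rule D-0009).  [cite: CoppersmithWinograd1982, Thm. 1] [cite: KnuthTAOCP2, §4.6.4, Ex. 67(e)]
[cite: LottiRomani1983, Prop. 3.3, Prop. 4.1] [cite: Blaser2013, Thm. 7.5]
-/

set_option linter.dupNamespace false

noncomputable section

open scoped BigOperators

namespace Summit.MatrixMultiplication.MatrixMultiplication.Theorems.FarEdgeDescentSubLogRatePlateau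

open Literature.Computability.AlgebraicComplexity
open Literature.Barriers.MatrixMultiplication

/-! ## §2 The words with one block `⟨a, b, a⟩` and `n` blocks `⟨1, q, 1⟩` -/

/-- In `(⟨a,b,a⟩ ⊕ ⟨1,q,1⟩)^{⊗(n+1)}` the `n+1` words with exactly one block `⟨a,b,a⟩` all have format
`⟨a, b·qⁿ, a⟩`, so `(⟨a,b,a⟩ ⊕ ⟨1,q,1⟩)^{⊗(n+1)} ≥ ⟨n+1⟩ ⊗ ⟨a, b·qⁿ, a⟩` (Schönhage 1981; Lotti–Romani
1983, Prop. 3.3: one type class of the power of a direct sum). [cite: LottiRomani1983, Prop. 3.3] -/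
theorem tensorRestrictsTo_kroneckerPow_twoBlocks_single (K : Type) [Field K] (a b q n : ℕ) :
    TensorRestrictsTo (kroneckerPow (matMulDirectSum K ![a, 1] ![b, q] ![a, 1]) (n + 1))
      (kroneckerTensor (unitTensor K (n + 1)) (matMulTensor K a (b * q ^ n) a)) := by
  classical
  -- the word `rep i` has its block `0 = ⟨a,b,a⟩` at position `i` and `1 = ⟨1,q,1⟩` elsewhere
  refine tensorRestrictsTo_kroneckerPow_matMulDirectSum_multiple K ![a, 1] ![b, q] ![a, 1]
    (fun i j => if j = i then (0 : Fin 2) else 1) ?_ ?_ ?_ ?_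
  · intro i i' h
    by_contra hne
    have h1 := congrFun h i
    simp only [if_true, if_neg hne] at h1
    exact absurd h1 (by decide)
  · intro i
    have hf : (fun j => (![a, 1] : Fin 2 → ℕ) (if j = i then (0 : Fin 2) else 1)) =
        fun j => if j = i then a else 1 := funext fun j => by split_ifs <;> rfl
    rw [hf, Fin.prod_univ_succAbove _ i, if_pos rfl, Finset.prod_eq_one fun j _ => ?_, mul_one]
    exact if_neg (Fin.succAbove_ne i j)
  · intro i
    have hf : (fun j => (![b, q] : Fin 2 → ℕ) (if j = i then (0 : Fin 2) else 1)) =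
        fun j => if j = i then b else q := funext fun j => by split_ifs <;> rfl
    rw [hf, Fin.prod_univ_succAbove _ i, if_pos rfl,
      Finset.prod_congr rfl fun j _ => if_neg (Fin.succAbove_ne i j), Finset.prod_const,
      Finset.card_univ, Fintype.card_fin]
  · intro i
    have hf : (fun j => (![a, 1] : Fin 2 → ℕ) (if j = i then (0 : Fin 2) else 1)) =
        fun j => if j = i then a else 1 := funext fun j => by split_ifs <;> rfl
    rw [hf, Fin.prod_univ_succAbove _ i, if_pos rfl, Finset.prod_eq_one fun j _ => ?_, mul_one]
    exact if_neg (Fin.succAbove_ne i j)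

/-! ## §3 The Knuth–Coppersmith–Winograd augmentation, packed at the far edge -/

/-- **Packing bound.** Over an infinite field, let `ρ = R(⟨a,b,a⟩)`, `q = ρ + b − 2ab ≥ 0`.  Knuth's
form of the Coppersmith–Winograd (1982) acceleration gives `bR(⟨a,b,a⟩ ⊕ ⟨1,q,1⟩) ≤ ρ + b`
(`algBorderRank_matMulDirectSum_augment_le`), hence `R̃ ≤ ρ + b`; the one-block words of the `(n+1)`-st
power (§2) and the rectangular asymptotic sum inequality with multiplicity
(`mul_rpow_omegaRect_mid_le_asymptoticRank`) give, for every real `x ≥ 0` with `aˣ ≤ b qⁿ`,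
`(n+1) · a^{ω(1,x,1)} ≤ (ρ + b)^{n+1}`. [cite: KnuthTAOCP2, §4.6.4, Ex. 67(e)]
[cite: CoppersmithWinograd1982, Thm. 1] [cite: LottiRomani1983, Prop. 3.3] -/
theorem knuth_packing_bound (K : Type) [Field K] [Infinite K] {a b ρ q : ℕ} (n : ℕ) (ha : 2 ≤ a)
    (hρ : tensorRank (matMulTensor K a b a) = ρ) (hq : q + (a * b + b * a) = ρ + b)
    {x : ℝ} (hx : 0 ≤ x) (hxB : (a : ℝ) ^ x ≤ ((b * q ^ n : ℕ) : ℝ)) :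
    ((n : ℝ) + 1) * (a : ℝ) ^ omegaRect K 1 x 1 ≤ ((ρ : ℝ) + b) ^ (n + 1) := by
  classical
  set D := matMulDirectSum K ![a, 1] ![b, q] ![a, 1] with hD
  -- Knuth: `bR(D) ≤ ρ + b`
  have hbr : algBorderRank D ≤ ρ + b := by
    have h := algBorderRank_matMulDirectSum_augment_le K a b a (by rw [hρ]; omega)
    rw [hρ, show ρ + b - (a * b + b * a) = q by omega] at h
    exact h
  have hR : asymptoticRank D ≤ (ρ : ℝ) + b := by
    exact_mod_cast asymptoticRank_le_of_algBorderRank_le hbr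
  have hpow : asymptoticRank (kroneckerPow D (n + 1)) ≤ ((ρ : ℝ) + b) ^ (n + 1) :=
    (asymptoticRank_kroneckerPow_le D (Nat.succ_pos n)).trans
      (pow_le_pow_left₀ (asymptoticRank_nonneg D) hR _)
  have hres := (tensorRestrictsTo_kroneckerPow_twoBlocks_single K a b q n).polyDegeneratesTo
  have h1 := mul_rpow_omegaRect_mid_le_asymptoticRank K hx (Nat.succ_pos n) ha hxB
  have h2 := asymptoticRank_le_of_polyDegeneratesTo hres
  have h3 := h1.trans (h2.trans hpow)
  push_cast at h3
  exact h3

/-! ## §4 The plateau: `e ≤ 3 / log a` beyond the format `β + Λ·log(ρ + a^β)/log a` -/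

/-- **Plateau bound.** Over an infinite field let `a ≥ 2`, `ρ = R(⟨a, a^β, a⟩)`,
`q = ρ + a^β − 2a^{β+1}` and `Λ = q / a^{β+1} ≥ 2`.  Then the far-edge excess
`e(k) = ω(1,k,1) − (k+1)` satisfies `e(k) ≤ 3 / log a` for every real `k ≥ β + Λ · log(ρ + a^β)/log a`:
the packing bound of §3 with `n = ⌊Λ⌋` copies at the format `x = β + n log q / log a` (where
`aˣ = a^β qⁿ` exactly) gives `e(x) · log a ≤ (n+1) log((ρ+a^β)/q) + log Λ − log(n+1) ≤ 2(n+1)/Λ ≤ 3`, and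
`k ↦ e(k)` is antitone (`omegaRect_one_mid_one_sub_antitone`).  The type `u = 2/n` step of Lotti–Romani's
Prop. 4.1, run on the Knuth–Coppersmith–Winograd augmentation instead of Schönhage's `⟨n,1,n⟩ ⊕ ⟨1,(n−1)²,1⟩`.
[cite: LottiRomani1983, Prop. 4.1] [cite: KnuthTAOCP2, §4.6.4, Ex. 67(e)] -/
theorem excess_plateau (K : Type) [Field K] [Infinite K] {β a ρ q : ℕ} (ha : 2 ≤ a)
    (hρ : tensorRank (matMulTensor K a (a ^ β) a) = ρ) (hq : q + 2 * a ^ (β + 1) = ρ + a ^ β)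
    (hΛ : 2 * a ^ (β + 1) ≤ q) {k : ℝ}
    (hk : (β : ℝ) + (q : ℝ) / (a : ℝ) ^ (β + 1) * (Real.log ((ρ : ℝ) + (a : ℝ) ^ β) / Real.log a) ≤ k) :
    omegaRect K 1 k 1 - (k + 1) ≤ 3 / Real.log a := by
  -- constants
  have ha0 : (0 : ℝ) < a := by exact_mod_cast (by omega : 0 < a)
  have ha1 : (1 : ℝ) < a := by exact_mod_cast (by omega : 1 < a)
  have hla : 0 < Real.log a := Real.log_pos ha1
  set A : ℝ := (a : ℝ) ^ (β + 1) with hA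
  have hA0 : 0 < A := pow_pos ha0 _
  have hAq : 2 * A ≤ q := by rw [hA]; exact_mod_cast hΛ
  have hq0 : (0 : ℝ) < q := by linarith
  set Λ : ℝ := (q : ℝ) / A with hΛdef
  have hΛ2 : 2 ≤ Λ := by rw [hΛdef, le_div_iff₀ hA0]; exact hAq
  have hΛ0 : 0 < Λ := by linarith
  set r : ℝ := (ρ : ℝ) + (a : ℝ) ^ β with hr
  have hrq : r - q = 2 * A := by
    have h : (q : ℝ) + 2 * (a : ℝ) ^ (β + 1) = ρ + (a : ℝ) ^ β := by exact_mod_cast hq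
    rw [hr, hA]; linarith
  have hr0 : 0 < r := by linarith
  have hqr : (q : ℝ) ≤ r := by linarith
  -- `n = ⌊Λ⌋`
  set n : ℕ := q / a ^ (β + 1) with hn
  have hnΛ : (n : ℝ) ≤ Λ := by
    have h : ((q / a ^ (β + 1) : ℕ) : ℝ) ≤ (q : ℝ) / ((a ^ (β + 1) : ℕ) : ℝ) :=
      Nat.cast_div_le (α := ℝ)
    rw [Nat.cast_pow] at h
    rw [hn, hΛdef, hA]
    exact h
  have hΛn : Λ < n + 1 := by
    have h1 : q < q / a ^ (β + 1) * a ^ (β + 1) + a ^ (β + 1) :=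
      Nat.lt_div_mul_add (pow_pos (by omega : 0 < a) (β + 1))
    have h2 : (q : ℝ) < (n : ℝ) * A + A := by rw [hn, hA]; exact_mod_cast h1
    rw [hΛdef, div_lt_iff₀ hA0]; linarith
  have hn0 : (0 : ℝ) < n + 1 := by positivity
  -- the format point `x = β + n log q / log a`, `a^x = a^β q^n`
  set x : ℝ := (β : ℝ) + (n : ℝ) * (Real.log q / Real.log a) with hx
  have hA1 : 1 ≤ A := one_le_pow₀ ha1.le
  have hlq0 : 0 ≤ Real.log q := Real.log_nonneg (by linarith)
  have hx0 : 0 ≤ x := by positivity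
  have hxk : x ≤ k := by
    refine le_trans ?_ hk
    rw [hx]
    have h1 : Real.log (q : ℝ) / Real.log a ≤ Real.log r / Real.log a :=
      div_le_div_of_nonneg_right (Real.log_le_log hq0 hqr) hla.le
    have h2 : (n : ℝ) * (Real.log q / Real.log a) ≤ Λ * (Real.log r / Real.log a) :=
      mul_le_mul hnΛ h1 (div_nonneg hlq0 hla.le) hΛ0.le
    linarith
  have haxB : (a : ℝ) ^ x ≤ ((a ^ β * q ^ n : ℕ) : ℝ) := by
    have h1 : (a : ℝ) ^ ((n : ℝ) * (Real.log q / Real.log a)) = (q : ℝ) ^ n := by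
      rw [Real.rpow_def_of_pos ha0, show Real.log a * ((n : ℝ) * (Real.log q / Real.log a)) =
        (n : ℝ) * Real.log q by field_simp, Real.exp_nat_mul, Real.exp_log hq0]
    rw [hx, Real.rpow_add ha0, Real.rpow_natCast, h1]
    push_cast
    exact le_rfl
  -- packing (§3) and logarithms
  have hq' : q + (a * a ^ β + a ^ β * a) = ρ + a ^ β := by
    rw [show a * a ^ β + a ^ β * a = 2 * a ^ (β + 1) by ring]; exact hq
  have hpack := knuth_packing_bound K n ha hρ hq' hx0 haxB
  have hω0 : 0 < (a : ℝ) ^ omegaRect K 1 x 1 := Real.rpow_pos_of_pos ha0 _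
  have hlog : Real.log ((n : ℝ) + 1) + omegaRect K 1 x 1 * Real.log a ≤ ((n : ℝ) + 1) * Real.log r := by
    have h := Real.log_le_log (mul_pos hn0 hω0) hpack
    rw [Real.log_mul hn0.ne' hω0.ne', Real.log_rpow ha0, Real.log_pow, Nat.cast_add_one, Nat.cast_pow] at h
    exact h
  -- the elementary estimates
  have hF1 : Real.log r - Real.log q ≤ (r - q) / q := by
    rw [← Real.log_div hr0.ne' hq0.ne']
    have := Real.log_le_sub_one_of_pos (div_pos hr0 hq0)
    rwa [div_sub_one hq0.ne'] at this
  have hF3 : Real.log Λ ≤ Real.log ((n : ℝ) + 1) := Real.log_le_log hΛ0 hΛn.le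
  have hF4 : Real.log Λ = Real.log q - (β + 1 : ℕ) * Real.log a := by
    rw [hΛdef, Real.log_div hq0.ne' hA0.ne', hA, Real.log_pow]
  have hF5 : ((n : ℝ) + 1) * ((r - q) / q) ≤ 3 := by
    rw [hrq, show 2 * A / (q : ℝ) = 2 / Λ by rw [hΛdef]; field_simp]
    rw [show ((n : ℝ) + 1) * (2 / Λ) = 2 * (((n : ℝ) + 1) / Λ) by ring]
    have h1 : ((n : ℝ) + 1) / Λ ≤ (Λ + 1) / Λ := div_le_div_of_nonneg_right (by linarith) hΛ0.le
    have h2 : (Λ + 1) / Λ = 1 + 1 / Λ := by field_simp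
    have h3 : 1 / Λ ≤ 1 / 2 := one_div_le_one_div_of_le (by norm_num) hΛ2
    linarith
  -- assemble: `e(x) log a ≤ 3`
  have hex : (omegaRect K 1 x 1 - (x + 1)) * Real.log a ≤ 3 := by
    have hxa : x * Real.log a = (β : ℝ) * Real.log a + (n : ℝ) * Real.log q := by
      rw [hx]; field_simp
    have h1 : ((n : ℝ) + 1) * (Real.log r - Real.log q) ≤ ((n : ℝ) + 1) * ((r - q) / q) :=
      mul_le_mul_of_nonneg_left hF1 hn0.le
    push_cast at hF4
    nlinarith [hlog, hF3, hF4, hF5, h1, hxa]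
  have hek : omegaRect K 1 k 1 - (k + 1) ≤ omegaRect K 1 x 1 - (x + 1) := by
    have := omegaRect_one_mid_one_sub_antitone K hxk
    simp only at this
    linarith
  rw [le_div_iff₀ hla]
  exact le_trans (mul_le_mul_of_nonneg_right hek hla.le) hex

end Summit.MatrixMultiplication.MatrixMultiplication.Theorems.FarEdgeDescentSubLogRatePlateau

end
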